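import Mathlib
import HarnessLib
import Literature.MathematicalPhysics.QuantumFieldTheory.ConstructiveQFTWave0

/-!
# THE VOLUME-UNIFORMITY PRINCIPLE for local, covering-natural force fields on the torus: sup and Lipschitz constants on ONE reference torus bound EVERY volume (any link group, any force)

HONEST FRAMING: exact (Metropolis-corrected) sampling algorithms for lattice gauge theory;
figures of merit are autocorrelation/cost numbers at stated couplings and volumes; no
continuum-physics claim.

Venture `LatticeQCDFlow` (cell pub-lqcd), topic `Exactness`; FANOUT row 14 (`eng-flowhmc`), written
for every engine row whose multi-step convergence theorem asks for a force field BOUNDED per link and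
LIPSCHITZ in a sup norm (rows 9 / 10 / 14: `…_uniformlyErgodic_of_trajLength`, `sunForce_bounds_of_contDiff`,
`su2WilsonFlowLO_exactForce_regular`) and obtains the constants by compactness on one torus — "not
uniform in the volume".  NEW WORK of the cell over the Literature's torus `Site d L = (Fin d → ZMod L)`
(`ConstructiveQFTWave0`) and Mathlib (`ZMod.castHom`, `ZMod.valMinAbs`, Pi sup norms); nothing is cited
as a fact; no number.  Group-agnostic companion of the GEN-15 chain (`SU2ExactForceTransplant`,
`SU2ExactForceVolumeUniform` instantiate it for the exact force through the `SU(2)` LO member).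

THE PRINCIPLE.  A family `Φ_L : (links of the L-torus → G) → (links → E)`, one field per side `L` in an
admissible class (`w ∣ L`: the sides on which the masks live), such that
(NAT) `Φ_{L'}(V∘σ̂) = Φ_L(V)∘σ̂` for every covering `σ : ℤ/L' → ℤ/L` (`L ∣ L'`, `ZMod.castHom`) of an
admissible `L`, and (LOC) on every admissible torus `Φ_L(V)_l` only depends on `V` on the `R`-ball at
`l.1` (balls by integer representatives, wrapping allowed).  THEN the constants of ONE admissible reference
side `L₁ > 2R` serve all: `‖Φ_L(V)_l‖ ≤ B` and `‖Φ_L(V) − Φ_L(V')‖ ≤ K‖c∘V − c∘V'‖_∞` for EVERY admissible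
`L`, where `c : G → M` is any coordinate map of the links (e.g. the matrix entries) — because
`Φ_L(V)_l = Φ_{L₁}(V♭)_{l₁}` with the window transplant `V♭` (go up to the `(L·L₁)`-torus by (NAT), move
by (LOC), come down by (NAT)), and the transplant is `1`-Lipschitz.

* §1 `valMinAbs_intCast_of_abs_le`; **`transplant_agree`** — on the `(L·L₁)`-torus the pull-back of `V`
  along `π₁` and of `V♭` along `π₂` agree on the `R`-ball at the lift of the centre (`2R < L₁`);
  `norm_comp_transplant_sub_le` (the transplant is `1`-Lipschitz after any coordinate map);
* §2 **`latticeForce_transplant`** (`Φ_L(V)_l = Φ_{L₁}(V♭)_{l₁}`) and **`latticeForce_volume_uniform`**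
  (the principle).

NOT CLAIMED: which engine forces satisfy (NAT)/(LOC) (the `SU(2)` LO member: `SU2ExactForceCovering`,
`SU2WilsonFlowLOLocality`; others not typed); anything about the Doeblin RATE; any number.
-/

noncomputable section

namespace Summit.Ventures.LatticeQCDFlow.Exactness

open Literature.MathematicalPhysics.QuantumFieldTheory

/-! ## §1 The window transplant -/

section Transplant

variable {d L L₁ : ℕ}

/-- `valMinAbs` recovers a small integer representative: `|z| ≤ R`, `2R < n` ⇒ `valMinAbs (z mod n) = z`. -/
theorem valMinAbs_intCast_of_abs_le {n : ℕ} [NeZero n] {z : ℤ} {R : ℕ} (hz : |z| ≤ (R : ℤ)) (hR : 2 * R < n) :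
    ((z : ZMod n)).valMinAbs = z := by
  rw [ZMod.valMinAbs_spec]
  have hR' : (2 * R : ℤ) < n := by exact_mod_cast hR
  obtain ⟨h1, h2⟩ := abs_le.1 hz
  exact ⟨rfl, by linarith, by linarith⟩

variable [NeZero L] [NeZero L₁]

/-- **The lift and the transplant agree on the window.**  On the `(L·L₁)`-torus, the pull-back of `V`
along `π₁ : ℤ/(L L₁) → ℤ/L` and the pull-back of the window transplant `V♭` (centre `c`, radius `R`)
along `π₂ : ℤ/(L L₁) → ℤ/L₁` agree on the `R`-ball at the lift `ĉ = (val cᵢ)ᵢ`, as soon as `2R < L₁`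
(any link type with a `1`). -/
theorem transplant_agree {G : Type*} [One G] (c : Site d L) {R : ℕ} (hR : 2 * R < L₁) (V : Edge d L → G) :
    ∀ e : Edge d (L*L₁), (∃ z : Fin d → ℤ, (∀ i, |z i| ≤ ((R : ℕ) : ℤ)) ∧ e.1 = (fun i => (((c i).val : ℕ) : ZMod (L*L₁))) + fun i => ((z i : ℤ) : ZMod (L*L₁))) →
      (fun e : Edge d (L*L₁) => V (fun i => (ZMod.castHom (dvd_mul_right L L₁) (ZMod L)) (e.1 i), e.2)) e =
        (fun e : Edge d (L*L₁) => (fun e₁ : Edge d L₁ => if (∀ i, |ZMod.valMinAbs (e₁.1 i - (((c i).val : ℕ) : ZMod L₁))| ≤ ((R : ℕ) : ℤ)) then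
        V (fun i => c i + ((ZMod.valMinAbs (e₁.1 i - (((c i).val : ℕ) : ZMod L₁)) : ℤ) : ZMod L), e₁.2) else 1) (fun i => (ZMod.castHom (dvd_mul_left L₁ L) (ZMod L₁)) (e.1 i), e.2)) e := by
  intro e he
  obtain ⟨z, hz, he⟩ := he
  have hvz : ∀ i, ZMod.valMinAbs ((z i : ℤ) : ZMod L₁) = z i := fun i => valMinAbs_intCast_of_abs_le (hz i) hR
  have h1 : ∀ i, (ZMod.castHom (dvd_mul_right L L₁) (ZMod L)) ((((c i).val : ℕ) : ZMod (L*L₁)) + ((z i : ℤ) : ZMod (L*L₁))) =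
      c i + ((z i : ℤ) : ZMod L) := fun i => by
    rw [map_add, map_natCast, map_intCast, ZMod.natCast_zmod_val]
  have h2 : ∀ i, (ZMod.castHom (dvd_mul_left L₁ L) (ZMod L₁)) ((((c i).val : ℕ) : ZMod (L*L₁)) + ((z i : ℤ) : ZMod (L*L₁))) =
      (((c i).val : ℕ) : ZMod L₁) + ((z i : ℤ) : ZMod L₁) := fun i => by
    rw [map_add, map_natCast, map_intCast]
  simp only [he, Pi.add_apply, h1, h2, add_sub_cancel_left, hvz, hz, implies_true, ite_true]

/-- **The transplant is `1`-Lipschitz after any coordinate map `c` of the links** (sup norms): every link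
of `V♭` is a link of `V` or the constant `1`. -/
theorem norm_comp_transplant_sub_le {G : Type*} [One G] {M : Type*} [NormedAddCommGroup M] (cM : G → M)
    (c : Site d L) (R : ℕ) (V V' : Edge d L → G) :
    ‖(cM ∘ (fun e₁ : Edge d L₁ => if (∀ i, |ZMod.valMinAbs (e₁.1 i - (((c i).val : ℕ) : ZMod L₁))| ≤ ((R : ℕ) : ℤ)) then
        V (fun i => c i + ((ZMod.valMinAbs (e₁.1 i - (((c i).val : ℕ) : ZMod L₁)) : ℤ) : ZMod L), e₁.2) else 1)) -
        (cM ∘ (fun e₁ : Edge d L₁ => if (∀ i, |ZMod.valMinAbs (e₁.1 i - (((c i).val : ℕ) : ZMod L₁))| ≤ ((R : ℕ) : ℤ)) then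
        V' (fun i => c i + ((ZMod.valMinAbs (e₁.1 i - (((c i).val : ℕ) : ZMod L₁)) : ℤ) : ZMod L), e₁.2) else 1))‖ ≤
      ‖cM ∘ V - cM ∘ V'‖ := by
  refine pi_norm_le_iff_of_nonneg (norm_nonneg _) |>.2 fun e₁ => ?_
  simp only [Pi.sub_apply, Function.comp_apply]
  split_ifs with h
  · exact norm_le_pi_norm (cM ∘ V - cM ∘ V') _
  · simp

end Transplant

/-! ## §2 The principle -/

section Principle

variable {d w : ℕ} {G : Type*} [One G] {E : Type*} [NormedAddCommGroup E] {M : Type*} [NormedAddCommGroup M]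

omit [NormedAddCommGroup E] in
/-- **The transplant identity for a natural, local family of force fields.**  If `Φ` is natural under
coverings of admissible tori (`w ∣ L`) and `R`-local on every admissible torus, then for every admissible
reference side `L₁` with `2R < L₁`, every admissible `L`, every field `V` and link `l` of the `L`-torus:
`Φ_L(V)_l = Φ_{L₁}(V♭)_{(c₁, l.2)}` (`c = l.1`, `c₁ = (val cᵢ mod L₁)ᵢ`, `V♭` the window transplant). -/
theorem latticeForce_transplant (Φ : ∀ L : ℕ, (Edge d L → G) → Edge d L → E) {R L₁ : ℕ} [NeZero L₁]
    (hwL₁ : w ∣ L₁) (hR : 2 * R < L₁)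
    (hnat : ∀ (L L' : ℕ) [NeZero L] [NeZero L'] (h : L ∣ L'), w ∣ L → ∀ (V : Edge d L → G) (e' : Edge d L'),
      Φ L' (fun e : Edge d L' => V (fun i => ZMod.castHom h (ZMod L) (e.1 i), e.2)) e' =
        Φ L V ((fun j => ZMod.castHom h (ZMod L) (e'.1 j)), e'.2))
    (hloc : ∀ (L : ℕ) [NeZero L], w ∣ L → ∀ (V W : Edge d L → G) (l : Edge d L),
      (∀ e : Edge d L, (∃ z : Fin d → ℤ, (∀ i, |z i| ≤ ((R : ℕ) : ℤ)) ∧ e.1 = l.1 + fun i => ((z i : ℤ) : ZMod L)) → V e = W e) → Φ L V l = Φ L W l)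
    {L : ℕ} [NeZero L] (hwL : w ∣ L) (V : Edge d L → G) (l : Edge d L) (c : Site d L) (hc : c = l.1) :
    Φ L V l = Φ L₁ (fun e₁ : Edge d L₁ => if (∀ i, |ZMod.valMinAbs (e₁.1 i - (((c i).val : ℕ) : ZMod L₁))| ≤ ((R : ℕ) : ℤ)) then
        V (fun i => c i + ((ZMod.valMinAbs (e₁.1 i - (((c i).val : ℕ) : ZMod L₁)) : ℤ) : ZMod L), e₁.2) else 1) ((fun i => (((c i).val : ℕ) : ZMod L₁)), l.2) := by
  subst hc
  haveI : NeZero (L * L₁) := ⟨mul_ne_zero (NeZero.ne L) (NeZero.ne L₁)⟩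
  have hwM : w ∣ L * L₁ := Dvd.dvd.mul_right hwL _
  set W : Edge d L₁ → G := (fun e₁ : Edge d L₁ => if (∀ i, |ZMod.valMinAbs (e₁.1 i - (((l.1 i).val : ℕ) : ZMod L₁))| ≤ ((R : ℕ) : ℤ)) then
        V (fun i => l.1 i + ((ZMod.valMinAbs (e₁.1 i - (((l.1 i).val : ℕ) : ZMod L₁)) : ℤ) : ZMod L), e₁.2) else 1) with hW
  have hcE : ((fun j => (ZMod.castHom (dvd_mul_right L L₁) (ZMod L)) ((fun i => (((l.1 i).val : ℕ) : ZMod (L*L₁))) j)), l.2) = l :=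
    Prod.ext (funext fun j => by simp only [map_natCast, ZMod.natCast_zmod_val]) rfl
  have hcE₁ : ((fun j => (ZMod.castHom (dvd_mul_left L₁ L) (ZMod L₁)) ((fun i => (((l.1 i).val : ℕ) : ZMod (L*L₁))) j)), l.2) = ((fun i => (((l.1 i).val : ℕ) : ZMod L₁)), l.2) :=
    Prod.ext (funext fun j => by simp only [map_natCast]) rfl
  have step1 := hnat L (L * L₁) (dvd_mul_right L L₁) hwL V ((fun i => (((l.1 i).val : ℕ) : ZMod (L*L₁))), l.2)
  rw [hcE] at step1
  have hT := transplant_agree (L := L) (L₁ := L₁) l.1 hR V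
  rw [← hW] at hT
  have step2 := hloc (L * L₁) hwM _ _ (((fun i => (((l.1 i).val : ℕ) : ZMod (L*L₁))) : Site d (L*L₁)), l.2) hT
  have step3 := hnat L₁ (L * L₁) (dvd_mul_left L₁ L) hwL₁ W ((fun i => (((l.1 i).val : ℕ) : ZMod (L*L₁))), l.2)
  rw [hcE₁] at step3
  rw [← step1, step2, step3]

/-- **THE VOLUME-UNIFORMITY PRINCIPLE.**  A family of force fields natural under coverings of admissible
tori and `R`-local on each; an admissible reference side `L₁` with `2R < L₁` on which `‖Φ_{L₁}(V)_l‖ ≤ B`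
and `‖Φ_{L₁}(V) − Φ_{L₁}(V')‖ ≤ K‖c∘V − c∘V'‖` (`c : G → M` any coordinate map, sup norms, `K ≥ 0`):
THEN on EVERY admissible torus `‖Φ_L(V)_l‖ ≤ B` and `‖Φ_L(V) − Φ_L(V')‖ ≤ K‖c∘V − c∘V'‖` — the same
constants. -/
theorem latticeForce_volume_uniform (Φ : ∀ L : ℕ, (Edge d L → G) → Edge d L → E) (cM : G → M)
    {R L₁ : ℕ} [NeZero L₁] (hwL₁ : w ∣ L₁) (hR : 2 * R < L₁)
    (hnat : ∀ (L L' : ℕ) [NeZero L] [NeZero L'] (h : L ∣ L'), w ∣ L → ∀ (V : Edge d L → G) (e' : Edge d L'),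
      Φ L' (fun e : Edge d L' => V (fun i => ZMod.castHom h (ZMod L) (e.1 i), e.2)) e' =
        Φ L V ((fun j => ZMod.castHom h (ZMod L) (e'.1 j)), e'.2))
    (hloc : ∀ (L : ℕ) [NeZero L], w ∣ L → ∀ (V W : Edge d L → G) (l : Edge d L),
      (∀ e : Edge d L, (∃ z : Fin d → ℤ, (∀ i, |z i| ≤ ((R : ℕ) : ℤ)) ∧ e.1 = l.1 + fun i => ((z i : ℤ) : ZMod L)) → V e = W e) → Φ L V l = Φ L W l)
    {B K : ℝ} (hB : ∀ (V : Edge d L₁ → G) (l : Edge d L₁), ‖Φ L₁ V l‖ ≤ B)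
    (hK0 : 0 ≤ K) (hK : ∀ V V' : Edge d L₁ → G, ‖Φ L₁ V - Φ L₁ V'‖ ≤ K * ‖cM ∘ V - cM ∘ V'‖)
    {L : ℕ} [NeZero L] (hwL : w ∣ L) :
    (∀ (V : Edge d L → G) (l : Edge d L), ‖Φ L V l‖ ≤ B) ∧
    (∀ V V' : Edge d L → G, ‖Φ L V - Φ L V'‖ ≤ K * ‖cM ∘ V - cM ∘ V'‖) := by
  have htr := fun (V : Edge d L → G) (l : Edge d L) =>
    latticeForce_transplant Φ hwL₁ hR hnat hloc hwL V l l.1 rfl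
  refine ⟨fun V l => ?_, fun V V' => ?_⟩
  · rw [htr V l]
    exact hB _ _
  · have key : ∀ (f g : Edge d L₁ → E) (i : Edge d L₁), ‖f i - g i‖ ≤ ‖f - g‖ :=
      fun f g i => norm_le_pi_norm (f - g) i
    refine (pi_norm_le_iff_of_nonneg (by positivity)).2 fun l => ?_
    rw [Pi.sub_apply, htr V l, htr V' l]
    exact ((key _ _ _).trans (hK _ _)).trans (mul_le_mul_of_nonneg_left (norm_comp_transplant_sub_le cM l.1 R V V') hK0)

end Principle

/-! ## §3 Local formulas: a force given on every torus by ONE local formula of the links is natural and local, hence volume-uniform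

(Appended, GEN-15.)  `Φ_L(V)_l = ψ (q ↦ V (l.1 + (q.1 mod L), q.2))` for a single `ψ` on the windows
`(Fin d → ℤ) × Fin d → G` that ignores offsets beyond radius `R`: this is the shape of every engine force
routine (a fixed stencil of neighbouring links — Wilson, improved, stout, the flowed forces of rows 9 /
10 / 14 once written as a stencil).  Such a family is natural under coverings and `R`-local, so the
principle gives: the constants of one reference torus of side `> 2R` serve EVERY side `L ≥ 1`. -/

section Formula

variable {d : ℕ} {G : Type*} [One G] {E : Type*} [NormedAddCommGroup E] {M : Type*} [NormedAddCommGroup M]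

omit [One G] [NormedAddCommGroup E] in
/-- **A local formula is natural under coverings**: pulling back along `ℤ/L' → ℤ/L` and reading the
stencil upstairs is reading the stencil downstairs at the projected base point. -/
theorem latticeForce_natural_of_formula (Φ : ∀ L : ℕ, (Edge d L → G) → Edge d L → E)
    (ψ : ((Fin d → ℤ) × Fin d → G) → E)
    (hψ : ∀ (L : ℕ) [NeZero L] (V : Edge d L → G) (l : Edge d L),
      Φ L V l = ψ (fun q : (Fin d → ℤ) × Fin d => V (l.1 + (fun i => ((q.1 i : ℤ) : ZMod L)), q.2)))
    (L L' : ℕ) [NeZero L] [NeZero L'] (h : L ∣ L') (V : Edge d L → G) (e' : Edge d L') :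
    Φ L' (fun e : Edge d L' => V (fun i => ZMod.castHom h (ZMod L) (e.1 i), e.2)) e' =
      Φ L V ((fun j => ZMod.castHom h (ZMod L) (e'.1 j)), e'.2) := by
  rw [hψ, hψ]
  congr 1
  funext q
  simp only [Pi.add_apply, map_add, map_intCast, Pi.add_def]

omit [One G] [NormedAddCommGroup E] in
/-- **A local formula of radius `R` is `R`-local**: if `V`, `W` agree on the `R`-ball at `l.1` then
`Φ_L(V)_l = Φ_L(W)_l`. -/
theorem latticeForce_local_of_formula (Φ : ∀ L : ℕ, (Edge d L → G) → Edge d L → E)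
    (ψ : ((Fin d → ℤ) × Fin d → G) → E)
    (hψ : ∀ (L : ℕ) [NeZero L] (V : Edge d L → G) (l : Edge d L),
      Φ L V l = ψ (fun q : (Fin d → ℤ) × Fin d => V (l.1 + (fun i => ((q.1 i : ℤ) : ZMod L)), q.2)))
    {R : ℕ} (hψR : ∀ f g : (Fin d → ℤ) × Fin d → G, (∀ q, (∀ i, |q.1 i| ≤ (R : ℤ)) → f q = g q) → ψ f = ψ g)
    (L : ℕ) [NeZero L] (V W : Edge d L → G) (l : Edge d L)
    (h : (∀ e : Edge d L, (∃ z : Fin d → ℤ, (∀ i, |z i| ≤ ((R : ℕ) : ℤ)) ∧ e.1 = l.1 + fun i => ((z i : ℤ) : ZMod L)) → V e = W e)) : Φ L V l = Φ L W l := by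
  rw [hψ, hψ]
  exact hψR _ _ fun q hq => h _ ⟨q.1, hq, rfl⟩

/-- **VOLUME-UNIFORMITY FOR A LOCAL FORMULA.**  A force family given by one stencil `ψ` of radius `R`
(as above), a reference side `L₁ > 2R` on which `‖Φ_{L₁}(V)_l‖ ≤ B` and
`‖Φ_{L₁}(V) − Φ_{L₁}(V')‖ ≤ K‖c∘V − c∘V'‖` (`K ≥ 0`, `c : G → M` any coordinate map): then on EVERY
torus `‖Φ_L(V)_l‖ ≤ B` and `‖Φ_L(V) − Φ_L(V')‖ ≤ K‖c∘V − c∘V'‖`. -/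
theorem latticeForce_volume_uniform_of_formula (Φ : ∀ L : ℕ, (Edge d L → G) → Edge d L → E) (cM : G → M)
    (ψ : ((Fin d → ℤ) × Fin d → G) → E)
    (hψ : ∀ (L : ℕ) [NeZero L] (V : Edge d L → G) (l : Edge d L),
      Φ L V l = ψ (fun q : (Fin d → ℤ) × Fin d => V (l.1 + (fun i => ((q.1 i : ℤ) : ZMod L)), q.2)))
    {R : ℕ} (hψR : ∀ f g : (Fin d → ℤ) × Fin d → G, (∀ q, (∀ i, |q.1 i| ≤ (R : ℤ)) → f q = g q) → ψ f = ψ g)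
    {L₁ : ℕ} [NeZero L₁] (hR : 2 * R < L₁) {B K : ℝ}
    (hB : ∀ (V : Edge d L₁ → G) (l : Edge d L₁), ‖Φ L₁ V l‖ ≤ B) (hK0 : 0 ≤ K)
    (hK : ∀ V V' : Edge d L₁ → G, ‖Φ L₁ V - Φ L₁ V'‖ ≤ K * ‖cM ∘ V - cM ∘ V'‖)
    {L : ℕ} [NeZero L] :
    (∀ (V : Edge d L → G) (l : Edge d L), ‖Φ L V l‖ ≤ B) ∧
    (∀ V V' : Edge d L → G, ‖Φ L V - Φ L V'‖ ≤ K * ‖cM ∘ V - cM ∘ V'‖) :=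
  latticeForce_volume_uniform (w := 1) Φ cM (one_dvd L₁) hR
    (fun L L' _ _ h _ V e' => latticeForce_natural_of_formula Φ ψ hψ L L' h V e')
    (fun L _ _ V W l hVW => latticeForce_local_of_formula Φ ψ hψ hψR L V W l hVW) hB hK0 hK (one_dvd L)

end Formula

/-! ## §4 Phase masks: the admissible tori

(Appended, GEN-15.)  The engine's masks are the phase colourings `x ↦ Σᵢ xᵢ mod w` of the tori with
`w ∣ L` (parity: `w = 2`).  They are proper for `w > 1` and compatible with every covering
`ℤ/M → ℤ/L` (`w ∣ L ∣ M`) — the admissibility structure the principle asks for. -/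

section Masks

variable {d : ℕ}

/-- **Phase masks of width `w > 1` are proper colourings** of every torus of side `L` with `w ∣ L`. -/
theorem phaseMask_proper {w L : ℕ} [Fact (1 < w)] (hwL : w ∣ L) (x : Site d L) (i : Fin d) :
    ZMod.castHom hwL (ZMod w) (∑ j, (Site.shift x i) j) ≠ ZMod.castHom hwL (ZMod w) (∑ j, x j) := by
  have h : ZMod.castHom hwL (ZMod w) (∑ j, (Site.shift x i) j) = ZMod.castHom hwL (ZMod w) (∑ j, x j) + 1 := by
    simp only [Site.shift, Pi.add_apply, Finset.sum_add_distrib, Finset.sum_pi_single', Finset.mem_univ,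
      if_true, map_add, map_one]
  rw [h]
  intro h'
  exact one_ne_zero (add_left_cancel (h'.trans (add_zero _).symm))

/-- **Phase masks are compatible with coverings**: for `w ∣ L ∣ M`, the width-`w` phase of `x : Site d M`
is the width-`w` phase of its projection to the `L`-torus. -/
theorem phaseMask_pull {w L M : ℕ} (hwM : w ∣ M) (hwL : w ∣ L) (hLM : L ∣ M) (x : Site d M) :
    ZMod.castHom hwM (ZMod w) (∑ j, x j) =
      ZMod.castHom hwL (ZMod w) (∑ j, (ZMod.castHom hLM (ZMod L)) (x j)) := by
  rw [← map_sum, ← RingHom.comp_apply,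
    Subsingleton.elim ((ZMod.castHom hwL (ZMod w)).comp (ZMod.castHom hLM (ZMod L))) (ZMod.castHom hwM (ZMod w))]

end Masks

end Summit.Ventures.LatticeQCDFlow.Exactness
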